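/-
Copyright: the b2b-balaban cell (near-miss cell 7), T⁴-continuum CRUX team (coordinator ruling e34b3e0c item (2)),
row-NE7b OWNER lineage `t4-ne7b-p1` (gen 104). Released under the licence of the surrounding project.
-/
import Summits.QuantumFields.BalabanUV.T4Continuum.Spine.NE7b.BarePartitionFnDecay

/-!
# NO K-UNIFORM FLOOR UNDER THE BARE WILSON PARTITION FUNCTIONS OF BAŁABAN's TORI — the owner's located finding
# F-ne7bp1-g103-2 (row NE7b, memo `t4/b2b-balaban-t4-ne7b-p1/g103/F-RHO-TOWER-g103.md` §1) COMPLETE IN KERNEL,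
# part 2 of 2

Cell `pub-balaban`, sub-cell `t4`, spine estimate NE7b (`T4WeightBudget.RelWeightBound`, the cell's OWN estimate — NOT
PRINTED, NOT PROVED).  Crux-route work under `Spine/NE7b/`; no `T4Continuum/Support` leaf typed, no `Prop` of Bałaban's
minted, no `[cite:]` tag; zero `sorry`.  Imports the sibling `BarePartitionFnDecay` (`Z(P, β) ≤ linkMass β ^ sitesPerDir`,
Haar independence over a link-disjoint plaquette family) and through it `DressingSupFloor`
(`partitionFn_ge_of_letters`: the END's letters force `exp(−|t|B_obs − ē n₁ − BA∞)·c₀ ≤ Z_K`).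

WHAT IS PROVED ([folklore]).
* `sitesPerDir_le_card_famSites`, `partitionFn_le_linkMass_pow_sitesPerDir` — the pivot family of `BarePartitionFnDecay`
  has at least `sitesPerDir 0` members (the sites `a·e₀`), so `Z(P, β) ≤ linkMass β ^ sitesPerDir 0` (`β ≥ 0`, `d ≥ 2`).
* `partitionFn_T4_le` — for the bare Wilson partition function of the `K`-th torus (`2·L^{m+K}` sites per direction
  of the finest lattice): `Z_K ≤ linkMass β ^ (2·L^{m+K})`, `β ≥ 0`.
* **`no_uniform_partitionFn_floor`** — if for `K ≥ K₀` the inverse couplings `β K ≥ 0` keep `linkMass (β K) ≤ θ < 1`,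
  then no `z₀ > 0` lies below all `Z_K`, `K ≥ K₀` (`Z_K ≤ θ^{2L^{m+K}} ≤ θ^K → 0`).
* **`no_uniform_supLetter_envelope`** — F-ne7bp1-g103-2: the letter family of the (α) road's END records
  (`…TowerStepRangeDataLWR`, 1R ∕ 2R ∕ 3R, `HistReadDataLWL∕LWR`) — `hBρ : |ρ₀ K t y| ≤ B K t` with the K-UNIFORM
  envelope `hBA : log (B K t) ≤ BA∞`, the (2.50) floor letters `floor ∕ sites`, (B)'s `Cor3With` on the interval — is
  UNSATISFIABLE at the intended dressing `ρ₀ K t = e^{t·obs_K}·D.dens K (g₀ K) 0` (IR-102-1) together with the window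
  letter `linkMass ((g₀ K)⁻²) ≤ θ < 1` (`K ≥ K₀`); `linkMass_window_of_floor` reduces that letter to a coupling floor
  `(g₀ K)⁻² ≥ β_min` plus the single number `linkMass β_min < 1`.

HONEST REMARKS.  (i) The window letter is a hypothesis on the group, its trace and the bare couplings: the abstract
`GaugeGroup` interface allows `reTr ≡ 1` (then `Z_K = 1`, the END's letters are consistent, and the theory is trivial);
for a closed non-trivial subgroup of `U(N)` with the normalised trace and bare couplings in Bałaban's small window
(`(g₀ K)⁻² ≥ γ⁻² ≫ 1`) it holds — the number `linkMass β_min < 1` is NOT computed here.  (ii) This is a finding about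
the ARCHITECTURE of the cell's own END records (term-wise sup-norm bookkeeping of an un-normalised density discards the
bare-field entropy `1∕Z_K`), not about Bałaban's theorems: print carries the normalisation `e^{−E}` through the inductive
form ([Balaban1988Convergent] Thm 1; the tree's `Realisation.rho_zero`).  The END records stand as kernel objects; the
owner's ruling W-ne7bp1-g103-1 re-cut the road at `…NE7b.PinnedExtraction.ExtractionLaws`.  Nothing of Bałaban's is
asserted, valued or discharged.  NE7b NOT PRINTED ∕ NOT PROVED; spine PROVED 0∕9; rung (B)+1 on a FINITE torus — NOT
infinite volume, NOT the mass gap, NOT Clay.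
HONEST DEPENDENCY: continuum YM on T⁴ ⇐ BetaPertH ∧ nine spine estimates (0/9 proved); BetaPertH ⇐ (D1) ∧ (D4) ∧
CAP+tail; G-an2-4 gates asym, D1 and NE2/3/4.  This file changes none of it.
-/

set_option autoImplicit false

open MeasureTheory
open Literature.MathematicalPhysics.QuantumFieldTheory.Balaban1983to89
open Literature.MathematicalPhysics.QuantumFieldTheory.Balaban1983to89.Missing
open Literature.MathematicalPhysics.QuantumFieldTheory.Balaban1983to89.T4Continuum
open Literature.MathematicalPhysics.QuantumFieldTheory.Balaban1983to89.T4StabilitySocket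
open Summit.QuantumFields.BalabanUV.T4Continuum.NE7b.BarePartitionFnDecay

namespace Summit.QuantumFields.BalabanUV.T4Continuum.NE7b.BarePartitionFnNoFloor

noncomputable section

variable {G : Type*} [GaugeGroup G] [MeasurableSpace G] [HaarData G] [RegularGaugeGroup G]

/-! ## §0 The family has at least `sitesPerDir` members: `Z(P, β) ≤ linkMass β ^ sitesPerDir` -/

section Generic

variable (P : Params) (hd : 2 ≤ P.d)

omit [GaugeGroup G] [MeasurableSpace G] [HaarData G] [RegularGaugeGroup G] in
/-- The family has at least `sitesPerDir 0` members (the sites `a·e₀`). [folklore] -/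
theorem sitesPerDir_le_card_famSites : P.sitesPerDir 0 ≤ (famSites P hd).card := by
  classical
  let ι : ZMod (P.sitesPerDir 0) → Site P 0 :=
    fun a => Function.update (fun _ => (0 : ZMod (P.sitesPerDir 0))) (dirA P hd) a
  have hinj : Function.Injective ι := by
    intro a b h
    have h' := congrFun h (dirA P hd)
    simpa [ι] using h'
  have hsub : Finset.univ.image ι ⊆ famSites P hd := by
    intro x hx
    obtain ⟨a, _, rfl⟩ := Finset.mem_image.mp hx
    refine Finset.mem_filter.mpr ⟨Finset.mem_univ _, ?_⟩
    simp [ι, Function.update_of_ne (dirA_ne_dirB P hd).symm]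
  calc P.sitesPerDir 0 = Fintype.card (ZMod (P.sitesPerDir 0)) := (ZMod.card _).symm
    _ = (Finset.univ.image ι).card := by rw [Finset.card_image_of_injective _ hinj, Finset.card_univ]
    _ ≤ (famSites P hd).card := Finset.card_le_card hsub

include hd in
/-- **`Z(P, β) ≤ linkMass β ^ (sites per direction of the finest torus)`** (`β ≥ 0`, `d ≥ 2`). [folklore] -/
theorem partitionFn_le_linkMass_pow_sitesPerDir {β : ℝ} (hβ : 0 ≤ β) :
    partitionFn (G := G) P β ≤ linkMass (G := G) β ^ P.sitesPerDir 0 :=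
  (partitionFn_le_linkMass_pow P hd hβ).trans
    (pow_le_pow_of_le_one (linkMass_nonneg β) (linkMass_le_one hβ) (sitesPerDir_le_card_famSites P hd))

end Generic

/-! ## §1 Bałaban's `K`-th torus: `Z_K ≤ linkMass β ^ (2·L^{m+K})` -/

section T4

variable {F : T4Family}

omit [GaugeGroup G] [MeasurableSpace G] [HaarData G] [RegularGaugeGroup G] in
/-- `d = 4 ≥ 2` for the `K`-th approximation. [folklore] -/
theorem two_le_d (K : ℕ) : 2 ≤ (F.P K).d := by
  show 2 ≤ 4
  omega

omit [GaugeGroup G] [MeasurableSpace G] [HaarData G] [RegularGaugeGroup G] in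
/-- `K ≤ 2·L^{m+K}` (crude; `L ≥ 2`). [folklore] -/
theorem le_sitesPerDir_T4 (K : ℕ) : K ≤ 2 * F.L ^ (F.m + K) := by
  have hL : 2 ≤ F.L := by have := F.hL.2; omega
  have h1 : K < 2 ^ K := K.lt_two_pow_self
  have h2 : 2 ^ K ≤ F.L ^ K := Nat.pow_le_pow_left hL K
  have h3 : F.L ^ K ≤ F.L ^ (F.m + K) := Nat.pow_le_pow_right (by omega) (by omega)
  omega

/-- **`Z_K ≤ linkMass β ^ (2·L^{m+K})`** for the bare Wilson partition function of the `K`-th torus, `β ≥ 0`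
(`T4Family.sitesPerDir_eq`: `2·L^{m+K}` sites per direction of the finest lattice). [folklore] -/
theorem partitionFn_T4_le (K : ℕ) {β : ℝ} (hβ : 0 ≤ β) :
    partitionFn (G := G) (F.P K) β ≤ linkMass (G := G) β ^ (2 * F.L ^ (F.m + K)) := by
  rw [← T4Family.sitesPerDir_eq]
  exact partitionFn_le_linkMass_pow_sitesPerDir (F.P K) (two_le_d K) hβ

/-! ## §2 No K-uniform floor; F-ne7bp1-g103-2 complete -/

/-- **NO K-UNIFORM POSITIVE FLOOR UNDER `Z_K` IN A DECAY WINDOW.**  If for all `K ≥ K₀` the inverse couplings `β K ≥ 0`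
keep the single-plaquette mass `linkMass (β K) ≤ θ` with `θ < 1`, then no `z₀ > 0` bounds `Z_K` below for all
`K ≥ K₀` (`Z_K ≤ θ^{2L^{m+K}} ≤ θ^K → 0`). [folklore] -/
theorem no_uniform_partitionFn_floor {z₀ θ : ℝ} (hz : 0 < z₀) (hθ : θ < 1) (β : ℕ → ℝ) (K₀ : ℕ)
    (hβ : ∀ K, K₀ ≤ K → 0 ≤ β K) (hm : ∀ K, K₀ ≤ K → linkMass (G := G) (β K) ≤ θ)
    (hZ : ∀ K, K₀ ≤ K → z₀ ≤ partitionFn (G := G) (F.P K) (β K)) : False := by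
  have hθ0 : 0 ≤ θ := (linkMass_nonneg (β K₀)).trans (hm K₀ le_rfl)
  obtain ⟨K₁, hK₁⟩ := Filter.eventually_atTop.mp
    ((tendsto_pow_atTop_nhds_zero_of_lt_one hθ0 hθ).eventually_mem (Iio_mem_nhds hz))
  have hK₀ : K₀ ≤ max K₀ K₁ := le_max_left _ _
  have h1 := hZ (max K₀ K₁) hK₀
  have h2 := partitionFn_T4_le (G := G) (F := F) (max K₀ K₁) (hβ _ hK₀)
  have h3 : linkMass (G := G) (β (max K₀ K₁)) ^ (2 * F.L ^ (F.m + max K₀ K₁)) ≤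
      θ ^ (2 * F.L ^ (F.m + max K₀ K₁)) :=
    pow_le_pow_left₀ (linkMass_nonneg _) (hm _ hK₀) _
  have h4 : θ ^ (2 * F.L ^ (F.m + max K₀ K₁)) ≤ θ ^ (max K₀ K₁) :=
    pow_le_pow_of_le_one hθ0 hθ.le (le_sitesPerDir_T4 _)
  have h5 : θ ^ (max K₀ K₁) < z₀ := hK₁ _ (le_max_right _ _)
  linarith

/-- **F-ne7bp1-g103-2, COMPLETE IN KERNEL: THE END's LETTER FAMILY IS UNSATISFIABLE AT THE INTENDED DRESSING (in a
decay window).**  Suppose, for all cutoffs `K ≥ K₀`: the dressed initial density `y ↦ e^{t·obs_K y}·D.dens K (g₀ K) 0 y`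
(`|obs_K| ≤ B_obs`) has a sup letter `B K` (`hBρ`) with the K-UNIFORM envelope `log (B K) ≤ BA∞` (`hBA`); the (2.50)
floor letters hold (`c₀ ≤ smallFieldMass`, `numSites ≤ n₁`, `e₋(g_K) ≤ ē`); (B)'s `Cor3With` applies on the interval; and
the bare couplings stay in a window where the single-plaquette Haar mass is `≤ θ < 1`.  Then `False`:
`DressingSupFloor.partitionFn_ge_of_letters` gives the K-free floor `exp(−|t|B_obs − ē n₁ − BA∞)·c₀ ≤ Z_K`, and
`no_uniform_partitionFn_floor` refutes it.  So the (α) road's END records cannot be inhabited by the intended instance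
with a finite `BA∞` — the located finding behind ruling W-ne7bp1-g103-1 (road re-cut at
`…NE7b.PinnedExtraction.ExtractionLaws`).  The window letter is discussed in the module docstring. [folklore] -/
theorem no_uniform_supLetter_envelope (D : FiniteEpsData F G) (hsign : B16.SignConventions D.C)
    {γB : ℝ} {em ep : ℝ → ℝ} (hcor : B16.Cor3With D.C γB em ep) (g₀ : ℕ → ℝ) (K₀ : ℕ)
    (hI : ∀ K, K₀ ≤ K → (D.C ⟨K, F.m, g₀ K⟩).flow.InInterval γB K)
    (obs : ∀ K, GaugeField (F.P K) 0 G → ℝ) {Bobs : ℝ} (hobs : ∀ K y, |obs K y| ≤ Bobs) (t : ℝ)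
    (B : ℕ → ℝ) {BAi : ℝ}
    (hB : ∀ K, K₀ ≤ K → ∀ y, |Real.exp (t * obs K y) * D.dens K (g₀ K) 0 y| ≤ B K)
    (hBA : ∀ K, K₀ ≤ K → Real.log (B K) ≤ BAi)
    {c₀ n₁ ebar : ℝ} (hc₀ : 0 < c₀) (hfloor : ∀ K, K₀ ≤ K → c₀ ≤ smallFieldMass D K (g₀ K))
    (hsites : ∀ K, K₀ ≤ K → ((D.C ⟨K, F.m, g₀ K⟩).numSites K : ℝ) ≤ n₁)
    (hem : ∀ K, K₀ ≤ K → em ((D.C ⟨K, F.m, g₀ K⟩).flow.g K) ≤ ebar) (hem0 : 0 ≤ ebar)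
    {θ : ℝ} (hθ : θ < 1) (hm : ∀ K, K₀ ≤ K → linkMass (G := G) ((g₀ K)⁻¹ ^ 2) ≤ θ) : False :=
  no_uniform_partitionFn_floor (G := G) (F := F) (mul_pos (Real.exp_pos _) hc₀) hθ (fun K => (g₀ K)⁻¹ ^ 2) K₀
    (fun _ _ => sq_nonneg _) hm
    (fun K hK => DressingSupFloor.partitionFn_ge_of_letters D hsign hcor K (g₀ K) (hI K hK) (hobs K) t (hB K hK)
      (hBA K hK) hc₀ (hfloor K hK) (hsites K hK) (Nat.cast_nonneg _) (hem K hK) hem0)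

/-- The window letter from a coupling floor: if `(g₀ K)⁻² ≥ β_min` for `K ≥ K₀`, then
`linkMass ((g₀ K)⁻²) ≤ linkMass β_min` (antitonicity), so `θ := linkMass β_min` serves as soon as it is `< 1`. [folklore] -/
theorem linkMass_window_of_floor (g₀ : ℕ → ℝ) (K₀ : ℕ) {βmin : ℝ}
    (hβ : ∀ K, K₀ ≤ K → βmin ≤ (g₀ K)⁻¹ ^ 2) :
    ∀ K, K₀ ≤ K → linkMass (G := G) ((g₀ K)⁻¹ ^ 2) ≤ linkMass (G := G) βmin :=
  fun K hK => linkMass_antitone (hβ K hK)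

end T4

end

end Summit.QuantumFields.BalabanUV.T4Continuum.NE7b.BarePartitionFnNoFloor
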